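import Summits.KontsevichZagierPeriods.KontsevichZagierPeriods.Theorems.VietaFibreKernelFormItemDictionary
import Summits.KontsevichZagierPeriods.KontsevichZagierPeriods.Theorems.VietaFibreKernelFormIsSummit

/-!
# Crux `KernelForm` (stmt-KontsevichZagierPeriods-10447), route VietaFibre: the `[π]`-split and its glue

Route VietaFibre's deciding crux `KernelForm` (kernel form of Kontsevich–Zagier's Conjecture 1 for
the calculus of `KZCalculus.lean`; verbatim `KZKernelConjecture` = the summit, `kernelForm_iff_summit`)
is decomposed one level down along the element `[π]` (Kontsevich–Zagier 2001 §4.1, `P̂ = P[(2πi)⁻¹]`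
read in both directions; Ayoub 2014 Def. 6 / Conj. 7), into the two EXISTING shared items that route
VietaFibre carries as its own child declarations since rev 9:

* child 1 `VietaFibre.AyoubPiLocalKernel`  (item stmt-KontsevichZagierPeriods-0541): for every pinned
  family `P n r = [unit disc] × r`, every `c` of value `0` has `(lift (of ∘ P))^[N] c ∈ KZ.relations`
  for some `N` — evaluation is injective on `FormalRep ⧸ relations` localised at `[π]`;
* child 2 `VietaFibre.AyoubPiCancellation` (item stmt-KontsevichZagierPeriods-0540): for every pinned
  family, `lift (of ∘ P) c ∈ KZ.relations → c ∈ KZ.relations` — `[π]` is a non-zero-divisor.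

This file is the glue of that split, on the Theorems side:

* `KernelForm_of_subs` / `vietaFibre_KernelForm_of_subs` — child 1 → child 2 → `KernelForm`
  (under the AyoubSpecialisation names, resp. VietaFibre's own names of the children; one application
  of the landed item dictionary `kernelForm_iff_ayoubPiLocalKernel_and_ayoubPiCancellation`: child 1
  supplies the exponent `N`, child 2 peels the `N` factors `[π]` by induction);
* `KernelForm_of_subs'` — the same with both antecedents stated LITERALLY, and
  `kernelFormPiSplitGlue_proof : VietaFibre.KernelFormPiSplitGlue` — the route's glue item
  stmt-KontsevichZagierPeriods-18038, by name;
* `subs_of_kernelForm`, `vietaFibre_kernelForm_iff_subs` — the split is EXACT (each child is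
  necessary: child 1 with `N = 0`, child 2 because `eval ([π] ⋆ c) = π · eval c` and `π ≠ 0`);
* `summit_of_subs` — child 1 → child 2 → `KontsevichZagierPeriods`, and
  `assembly_proof : VietaFibre.Assembly` (`KernelForm → KontsevichZagierPeriods`, the route's assembly
  item stmt-KontsevichZagierPeriods-10496, by name: `kernelForm_iff_summit.mp`);
* the twin for route OctahedralSymmetry's (definitionally equal) name of the shared crux.

Nothing here is conjecture-grade and no statement of any item is altered; both children remain open
(conjecture-grade) items with their own registered lines. Sources: M. Kontsevich, D. Zagier, *Periods*
(2001), §1.2 Conjecture 1, §4.1; J. Ayoub, *Periods and the conjectures of Grothendieck and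
Kontsevich–Zagier*, EMS Newsl. 91 (2014), Def. 6, Conj. 7; A. Huber, G. Wüstholz, *Transcendence and
linear relations of 1-periods* (2022), App. A.3–A.4.
-/

noncomputable section

open Literature.NumberTheory.Transcendental
open Summit.KontsevichZagierPeriods.KontsevichZagierPeriods.Theses
open Summit.KontsevichZagierPeriods.KernelForm.LocaliseAtValuePrime

namespace Summit.KontsevichZagierPeriods.KernelForm.Split

/-! ### The glue: child 1 → child 2 → `KernelForm` -/

/-- **Glue of the `[π]`-split** (children under their AyoubSpecialisation names):
`AyoubPiLocalKernel` (stmt-0541) → `AyoubPiCancellation` (stmt-0540) → `VietaFibre.KernelForm`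
(stmt-10447). One application of `kernelForm_iff_ayoubPiLocalKernel_and_ayoubPiCancellation`.
[folklore] -/
theorem KernelForm_of_subs
    (h₁ : Summit.KontsevichZagierPeriods.KontsevichZagierPeriods.Theses.AyoubSpecialisation.AyoubPiLocalKernel)
    (h₂ : Summit.KontsevichZagierPeriods.KontsevichZagierPeriods.Theses.AyoubSpecialisation.AyoubPiCancellation) :
    Summit.KontsevichZagierPeriods.KontsevichZagierPeriods.Theses.VietaFibre.KernelForm :=
  kernelForm_iff_ayoubPiLocalKernel_and_ayoubPiCancellation.mpr ⟨h₁, h₂⟩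

/-- **Glue of the `[π]`-split over route VietaFibre's OWN child declarations** (rev 9; the same
terms as the AyoubSpecialisation names): `VietaFibre.AyoubPiLocalKernel` (stmt-0541) →
`VietaFibre.AyoubPiCancellation` (stmt-0540) → `VietaFibre.KernelForm` (stmt-10447). This is the
`--glue-by` declaration for the route's split edge. [folklore] -/
theorem vietaFibre_KernelForm_of_subs
    (h₁ : Summit.KontsevichZagierPeriods.KontsevichZagierPeriods.Theses.VietaFibre.AyoubPiLocalKernel)
    (h₂ : Summit.KontsevichZagierPeriods.KontsevichZagierPeriods.Theses.VietaFibre.AyoubPiCancellation) :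
    Summit.KontsevichZagierPeriods.KontsevichZagierPeriods.Theses.VietaFibre.KernelForm :=
  KernelForm_of_subs h₁ h₂

/-- **Glue with both antecedents stated literally** (the pinned-family typing of items 0541 and
0540, verbatim): child 1 → child 2 → `VietaFibre.KernelForm`. [folklore] -/
theorem KernelForm_of_subs' :
    (∀ (P : ∀ n : ℕ, KZ.IntegralRep n → KZ.IntegralRep (n + 2)),
      (∀ (n : ℕ) (r : KZ.IntegralRep n),
        (P n r).domain = {z : Fin (n + 2) → ℝ | z 0 ^ 2 + z 1 ^ 2 ≤ 1 ∧
            (fun i : Fin n => z i.succ.succ) ∈ r.domain} ∧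
          (P n r).integrand = fun z => r.integrand (fun i : Fin n => z i.succ.succ)) →
      ∀ c : KZ.FormalRep, KZ.eval c = 0 → ∃ N : ℕ,
        (⇑(FreeAbelianGroup.lift (fun s : (Σ n, KZ.IntegralRep n) => KZ.of (P s.1 s.2))))^[N] c ∈
          KZ.relations) →
    (∀ (P : ∀ n : ℕ, KZ.IntegralRep n → KZ.IntegralRep (n + 2)),
      (∀ (n : ℕ) (r : KZ.IntegralRep n),
        (P n r).domain = {z : Fin (n + 2) → ℝ | z 0 ^ 2 + z 1 ^ 2 ≤ 1 ∧
            (fun i : Fin n => z i.succ.succ) ∈ r.domain} ∧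
          (P n r).integrand = fun z => r.integrand (fun i : Fin n => z i.succ.succ)) →
      ∀ c : KZ.FormalRep,
        FreeAbelianGroup.lift (fun s : (Σ n, KZ.IntegralRep n) => KZ.of (P s.1 s.2)) c ∈
          KZ.relations → c ∈ KZ.relations) →
    Summit.KontsevichZagierPeriods.KontsevichZagierPeriods.Theses.VietaFibre.KernelForm :=
  fun h₁ h₂ => KernelForm_of_subs h₁ h₂

/-- **The route's glue item, by name**: `VietaFibre.KernelFormPiSplitGlue`
(stmt-KontsevichZagierPeriods-18038) — child 1 → child 2 → `KernelForm`. [folklore] -/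
theorem kernelFormPiSplitGlue_proof :
    Summit.KontsevichZagierPeriods.KontsevichZagierPeriods.Theses.VietaFibre.KernelFormPiSplitGlue :=
  KernelForm_of_subs'

/-! ### The split is exact -/

/-- **Conversely** the crux implies both children (under VietaFibre's names): child 1 with exponent
`N = 0`; child 2 because the crux gives cancellation of every canceller of non-zero value and
`eval ([π] ⋆ c) = π · eval c`, `π ≠ 0`. So neither child can be dropped from the split. [folklore] -/
theorem subs_of_kernelForm
    (hK : Summit.KontsevichZagierPeriods.KontsevichZagierPeriods.Theses.VietaFibre.KernelForm) :
    Summit.KontsevichZagierPeriods.KontsevichZagierPeriods.Theses.VietaFibre.AyoubPiLocalKernel ∧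
      Summit.KontsevichZagierPeriods.KontsevichZagierPeriods.Theses.VietaFibre.AyoubPiCancellation :=
  kernelForm_iff_ayoubPiLocalKernel_and_ayoubPiCancellation.mp hK

/-- **Exactness of the `[π]`-split over VietaFibre's own child declarations**:
`VietaFibre.KernelForm ↔ VietaFibre.AyoubPiLocalKernel ∧ VietaFibre.AyoubPiCancellation`
(stmt-10447 ↔ stmt-0541 ∧ stmt-0540). [folklore] -/
theorem vietaFibre_kernelForm_iff_subs :
    Summit.KontsevichZagierPeriods.KontsevichZagierPeriods.Theses.VietaFibre.KernelForm ↔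
      Summit.KontsevichZagierPeriods.KontsevichZagierPeriods.Theses.VietaFibre.AyoubPiLocalKernel ∧
        Summit.KontsevichZagierPeriods.KontsevichZagierPeriods.Theses.VietaFibre.AyoubPiCancellation :=
  ⟨subs_of_kernelForm, fun h => vietaFibre_KernelForm_of_subs h.1 h.2⟩

/-! ### Through to the summit -/

/-- **The route's assembly item, by name**: `VietaFibre.Assembly` (stmt-KontsevichZagierPeriods-10496),
`KernelForm → KontsevichZagierPeriods` — the kernel form of Conjecture 1 implies its two-representation
form over rational integrands (`kernelForm_iff_summit`, i.e. `kzKernelConjecture_iff_isRational`: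
`r.value = r'.value ⇒ eval ([r] − [r']) = 0 ⇒ [r] − [r'] ∈ relations`). [folklore] -/
theorem assembly_proof :
    Summit.KontsevichZagierPeriods.KontsevichZagierPeriods.Theses.VietaFibre.Assembly :=
  fun hK => kernelForm_iff_summit.mp hK

/-- **Child 1 → child 2 → the summit** `KontsevichZagierPeriods` (glue composed with the assembly).
[folklore] -/
theorem summit_of_subs
    (h₁ : Summit.KontsevichZagierPeriods.KontsevichZagierPeriods.Theses.VietaFibre.AyoubPiLocalKernel)
    (h₂ : Summit.KontsevichZagierPeriods.KontsevichZagierPeriods.Theses.VietaFibre.AyoubPiCancellation) :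
    KontsevichZagierPeriods :=
  assembly_proof (vietaFibre_KernelForm_of_subs h₁ h₂)

/-! ### The twin for route OctahedralSymmetry's name of the shared crux -/

/-- The same glue for route OctahedralSymmetry's (definitionally equal) name of the shared crux:
child 1 → child 2 → `OctahedralSymmetry.KernelForm`. [folklore] -/
theorem octahedralSymmetry_KernelForm_of_subs
    (h₁ : Summit.KontsevichZagierPeriods.KontsevichZagierPeriods.Theses.VietaFibre.AyoubPiLocalKernel)
    (h₂ : Summit.KontsevichZagierPeriods.KontsevichZagierPeriods.Theses.VietaFibre.AyoubPiCancellation) :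
    Summit.KontsevichZagierPeriods.KontsevichZagierPeriods.Theses.OctahedralSymmetry.KernelForm :=
  vietaFibre_KernelForm_of_subs h₁ h₂

end Summit.KontsevichZagierPeriods.KernelForm.Split
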